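import Literature.NumberTheory.EllipticCurves.KatoTwistedFinitenessProofs
import Literature.NumberTheory.EllipticCurves.KatoTwistedFinitenessDescent
import Literature.NumberTheory.EllipticCurves.KatoTwistedFinitenessEulerFactorsProofs
import Literature.NumberTheory.EllipticCurves.KatoTwistedFinitenessIsotypicProofs
import Literature.NumberTheory.GaloisRepresentations.KroneckerWeberCyclotomicField
import HarnessLib

/-!
# Kato, Cor. 14.3 (2), for an ARBITRARY finite abelian extension `K/ℚ`

K. Kato, *`p`-adic Hodge theory and values of zeta functions of modular forms*, Astérisque 295
(2004), Cor. 14.3 (p. 235): "Let `A` be an abelian variety over `ℚ` such that there is a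
surjective homomorphism `J₁(N) → A` for some `N ≥ 1`. Let `K` be a finite abelian extension of
`ℚ`, let `χ : Gal(K/ℚ) → ℂˣ` be a character, and assume `L(A, χ, 1) ≠ 0`. Then: […] (2) The
`χ`-part `A(K)^(χ)` is finite."  Here (p. 235) `L(A, χ, s)` means `L_S(f, χ, s)` "in which we
identify `χ` with the composite homomorphism `(ℤ/m)ˣ ≅ Gal(ℚ(ζ_m)/ℚ) → Gal(K/ℚ) → ℂˣ` for the
smallest integer `m ≥ 1` such that `K ⊂ ℚ(ζ_m)`, and `S = prime(m)`".

The tree vendors the case `A = E` an elliptic curve over `ℚ` (with newform `f`,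
`IsNewformOf W f`) and `K = ℚ(ζ_m)` ITSELF as the named fact
`kato_finite_chiPart_of_twistedLValue_ne_zero` (`KatoTwistedFiniteness.lean`, `m ≢ 2 (mod 4)`;
all `m` by `kato_finite_chiPart_cyclotomic_of_twistedLValue_ne_zero_of`,
`KatoTwistedFinitenessProofs.lean`), recording the general abelian `K` as a
`TODO(general form)`; `KatoTwistedFinitenessDescent.lean` does the descent step for a subfield
`K ⊂ ℚ(ζ_M)` GIVEN the embedding, a restriction map `Gal(ℚ(ζ_M)/ℚ) → Aut(K/ℚ)` and the
inflated Dirichlet character as data ("every finite abelian `K/ℚ` has one by Kronecker–Weber,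
which is not in Mathlib").  The Kronecker–Weber theorem is now a THEOREM of the tree
(`GaloisRepresentations.KroneckerWeber_holds`; `CyclotomicField` form
`exists_algHom_cyclotomicField_of_isAbelianGalois`), and this file discharges all of that side
data, giving part (2) of Cor. 14.3 for elliptic curves at its printed generality — an arbitrary
finite abelian extension `K/ℚ` and a character `ψ` of `Gal(K/ℚ)` — modulo the vendored fact
alone:

* §1 `exists_algEquiv_comp_eq_of_normal`, `exists_monoidHom_restrict_of_normal`,
  `exists_algEquiv_extend_of_normal`, `exists_algEquiv_comp_algHom_eq` — restriction of
  automorphisms of `L` along an embedding `ι : K → L` of a normal extension `K/F` (existence,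
  uniqueness, as a group homomorphism, surjectivity for `L/F` normal; two embeddings of `K` into
  a normal `L` differ by an automorphism of `L`) — Mathlib's `restrictNormal` / `liftNormal`
  freed from the `IsScalarTower` packaging;
* §2 the Dirichlet character attached to `ψ` — Kato's identification
  `(ℤ/M)ˣ ≅ Gal(ℚ(ζ_M)/ℚ) → Gal(K/ℚ) → ℂˣ` along `ι : K → ℚ(ζ_M)`: it EXISTS
  (`exists_dirichletCharacter_inflating`), is UNIQUE (`dirichletCharacter_inflating_unique`),
  is compatible with level raising (`inflating_changeLevel`) and — the one point needing an
  argument — is INDEPENDENT OF THE EMBEDDING: two embeddings `K → ℚ(ζ_M)` induce the same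
  character (`eq_of_inflating_of_algHom`, because `Gal(ℚ(ζ_M)/ℚ)` is abelian), and two
  admissible levels induce characters with a common inflation
  (`changeLevel_mul_eq_changeLevel_mul_of_inflating`); hence, by the level-independence of
  Kato's hypothesis (`exists_continuation_changeLevel_iff`,
  `KatoTwistedFinitenessEulerFactorsProofs.lean`), **"`L(E, ψ, 1) ≠ 0`" does not depend on the
  chosen `(M, ι)`** (`exists_continuation_iff_of_inflating`) — in particular it agrees with
  Kato's normalisation through the least `m`;
* §3 `exists_inflating_datum` — for `K/ℚ` finite abelian every character `ψ` of `Gal(K/ℚ)` HAS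
  such a datum `(M, ι, χ)` (Kronecker–Weber); §3' the dictionary with the tree's `H`-relative
  language: the Dirichlet characters inflated from `Gal(K/ℚ)` along `ι` are exactly those trivial
  on the automorphisms of `ℚ(ζ_M)` fixing `ι(K)` (`cyclotomicCharacterOf_eq_one_of_inflating`,
  `exists_monoidHom_inflating_of_cyclotomicCharacterOf_eq_one`);
* §4 `kato_finite_chiPart_abelianField_of_twistedLValue_ne_zero` — **Cor. 14.3 (2) for `E/ℚ`
  over an arbitrary finite abelian `K`**: for any datum `(M, ι, χ)` of `ψ`, if
  `L_{prime(M)}(f, χ, s) = ∑ χ(n) aₙ(f) n⁻ˢ` has an entire continuation with `L(1) ≠ 0` then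
  `E(K)^(ψ)` is finite (vendored fact over `ℚ(ζ_M)`, all moduli, descended along the
  equivariant injection `Point.map ι`, `finite_chiPart_of_equivariant`); the `∃`-datum form
  `kato_finite_chiPart_abelianField_of_exists`; and the form quantified over abstract finite
  abelian `K` with the normalisation-free hypothesis,
  `kato_finite_chiPart_of_isAbelianGalois_of_twistedLValue_ne_zero`, together with the
  equivalence of the "for all data" and "for some datum" hypotheses
  (`forall_inflating_iff_exists_inflating`);
* §5 summing over characters: if no `L(E, ψ, 1)` with `ψ` trivial on `H ⊂ Gal(K/ℚ)` vanishes,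
  the `H`-fixed points of `E(K)` are torsion (`isOfFinAddOrder_point_of_isAbelianGalois_of_kato`,
  through the isotypic exhaustion of `KatoTwistedFinitenessIsotypicProofs.lean`, Kato's remark
  p. 236); if no `L(E, ψ, 1)` at all vanishes, `E(K)` is finite
  (`finite_point_of_isAbelianGalois_of_kato`, with Mordell–Weil);
* §6 totally real `K`: complex conjugation `c ∈ Gal(ℚ(ζ_M)/ℚ)` (`φ ∘ c = conj ∘ φ`,
  `exists_algEquiv_apply_eq_conj`) maps to `-1 ∈ (ℤ/M)ˣ`
  (`coe_autEquivPow_eq_neg_one_of_apply_eq_conj`) and fixes the image of a totally real field, so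
  every character of `Gal(K/ℚ)` inflates to an EVEN Dirichlet character
  (`even_of_inflating_of_isTotallyReal`): over totally real abelian fields only even twists
  `L(E, χ, 1)` enter (`finite_point_of_isTotallyReal_of_kato`);
* §7 the same descent for a totally real `K` given only WITH AN EMBEDDING `K → ℚ(ζ_M)` (no
  `IsAbelianGalois` structure on `K` needed, the shape in which totally real layers of cyclotomic
  towers are handed around), and with Kato's conclusion taken as an ALGEBRAIC hypothesis: a
  character of `Gal(ℚ(ζ_M)/ℚ)` is trivial at complex conjugation iff it is even
  (`cyclotomicCharacterOf_eq_one_iff_even_of_apply_eq_conj`); if the `χ`-parts of `E(ℚ(ζ_M))`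
  are finite for all EVEN `χ` mod `M`, every point of `E` over a totally real `K → ℚ(ζ_M)` is
  torsion (`isOfFinAddOrder_point_of_isTotallyReal_of_forall_even_finite_chiPart`, ring-embedding
  form `…_of_ringHom`) and `E(K)` is finite (`finite_point_of_isTotallyReal_of_forall_even_…`);
  under the vendored fact this reads: `L(f, χ, 1) ≠ 0` for every even `χ` mod `M` ⇒ `E(K)` finite
  for every totally real `K → ℚ(ζ_M)` (`finite_point_of_isTotallyReal_cyclotomic_of_kato`) — the
  form in which Cor. 14.3 (2) controls the totally real layers `ℚ(ζ_{p^{n+1}})⁺ ⊃ K` of a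
  cyclotomic tower (compare Kato's Thm. 14.4, p. 236, for the full tower `∪ₙ ℚ(ζ_{m^n})`).

No new definitions, no named facts: theorems only (D-0026).  Kato's theorem itself (the Euler
system argument behind `kato_finite_chiPart_of_twistedLValue_ne_zero`) is NOT proved here and
enters as the hypothesis `hK`.

## References

* K. Kato, *`p`-adic Hodge theory and values of zeta functions of modular forms*, Astérisque 295
  (2004), 117–290: §6.2 (p. 161), Thm. 14.2, Cor. 14.3 and the remark between them (p. 235).
  [Kato2004Asterisque]
* L. C. Washington, *Introduction to Cyclotomic Fields*, 2nd ed. (1997), Thm. 14.1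
  (Kronecker–Weber). [Washington1997]
-/

noncomputable section

open scoped BigOperators

open WeierstrassCurve WeierstrassCurve.Affine CongruenceSubgroup Polynomial

namespace Literature.NumberTheory.EllipticCurves

/-! ### §1. Restriction of automorphisms along an embedding of a normal extension -/

section Restrict

variable {F K L : Type*} [Field F] [Field K] [Field L] [Algebra F K] [Algebra F L]

/-- **Restriction along an embedding.** If `K/F` is normal and `ι : K → L` is an `F`-embedding
into a field `L`, every `F`-automorphism `σ` of `L` restricts to `K`: there is `τ ∈ Aut(K/F)`
with `σ ∘ ι = ι ∘ τ` (Mathlib `AlgEquiv.restrictNormal` for the tower `F ⊂ K ⊂ L` defined by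
`ι`). [folklore] -/
theorem exists_algEquiv_comp_eq_of_normal [Normal F K] (ι : K →ₐ[F] L) (σ : L ≃ₐ[F] L) :
    ∃ τ : K ≃ₐ[F] K, ∀ x, σ (ι x) = ι (τ x) := by
  letI : Algebra K L := ι.toRingHom.toAlgebra
  haveI : IsScalarTower F K L := IsScalarTower.of_algebraMap_eq fun x => (ι.commutes x).symm
  exact ⟨σ.restrictNormal K, fun x => (AlgEquiv.restrictNormal_commutes σ K x).symm⟩

/-- The restriction of `exists_algEquiv_comp_eq_of_normal` is unique (`ι` is injective).
[folklore] -/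
theorem algEquiv_eq_of_comp_eq (ι : K →ₐ[F] L) {σ : L ≃ₐ[F] L} {τ τ' : K ≃ₐ[F] K}
    (h : ∀ x, σ (ι x) = ι (τ x)) (h' : ∀ x, σ (ι x) = ι (τ' x)) : τ = τ' :=
  AlgEquiv.ext fun x => (ι : K →+* L).injective ((h x).symm.trans (h' x))

/-- **Restriction is a group homomorphism** `Aut(L/F) → Aut(K/F)` along `ι` (Mathlib
`AlgEquiv.restrictNormalHom`). [folklore] -/
theorem exists_monoidHom_restrict_of_normal [Normal F K] (ι : K →ₐ[F] L) :
    ∃ r : (L ≃ₐ[F] L) →* (K ≃ₐ[F] K), ∀ σ x, σ (ι x) = ι (r σ x) := by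
  letI : Algebra K L := ι.toRingHom.toAlgebra
  haveI : IsScalarTower F K L := IsScalarTower.of_algebraMap_eq fun x => (ι.commutes x).symm
  exact ⟨AlgEquiv.restrictNormalHom K, fun σ x => (AlgEquiv.restrictNormal_commutes σ K x).symm⟩

/-- **Every automorphism of `K` extends** along `ι` when `L/F` is normal too (Mathlib
`AlgEquiv.restrictNormalHom_surjective`). [folklore] -/
theorem exists_algEquiv_extend_of_normal [Normal F K] [Normal F L] (ι : K →ₐ[F] L)
    (τ : K ≃ₐ[F] K) : ∃ σ : L ≃ₐ[F] L, ∀ x, σ (ι x) = ι (τ x) := by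
  letI : Algebra K L := ι.toRingHom.toAlgebra
  haveI : IsScalarTower F K L := IsScalarTower.of_algebraMap_eq fun x => (ι.commutes x).symm
  obtain ⟨σ, hσ⟩ := AlgEquiv.restrictNormalHom_surjective (F := F) (K₁ := K) (E := L) τ
  refine ⟨σ, fun x => ?_⟩
  rw [← hσ]
  exact (AlgEquiv.restrictNormal_commutes σ K x).symm

/-- **Two embeddings of `K` into a normal extension `L/F` differ by an automorphism of `L`**:
`ι₂ = σ₀ ∘ ι₁` for some `σ₀ ∈ Aut(L/F)` (Mathlib `AlgHom.liftNormal`, bijective since `L/F` is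
normal). [folklore] -/
theorem exists_algEquiv_comp_algHom_eq [Normal F L] (ι₁ ι₂ : K →ₐ[F] L) :
    ∃ σ₀ : L ≃ₐ[F] L, ∀ x, σ₀ (ι₁ x) = ι₂ x := by
  letI : Algebra K L := ι₁.toRingHom.toAlgebra
  haveI : IsScalarTower F K L := IsScalarTower.of_algebraMap_eq fun x => (ι₁.commutes x).symm
  let φ : L →ₐ[F] L := ι₂.liftNormal L
  refine ⟨AlgEquiv.ofBijective φ (AlgHom.normal_bijective F L L φ), fun x => ?_⟩
  have h := ι₂.liftNormal_commutes L x
  rw [Algebra.algebraMap_self, RingHom.id_apply] at h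
  exact h

end Restrict

/-! ### §2. The Dirichlet character attached to a character of `Gal(K/ℚ)` along `K ⊂ ℚ(ζ_M)` -/

section Inflation

variable {K : Type*} [Field K] [Algebra ℚ K]

set_option backward.isDefEq.respectTransparency false in
/-- A subfield of `ℚ(ζ_M)` is a (finite) abelian, in particular normal, extension of `ℚ`.
[folklore] -/
theorem isAbelianGalois_of_algHom_cyclotomic {M : ℕ} [NeZero M]
    (ι : K →ₐ[ℚ] CyclotomicField M ℚ) : IsAbelianGalois ℚ K :=
  (GaloisRepresentations.isAbelianGalois_of_algHom_cyclotomicField ι).1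

set_option backward.isDefEq.respectTransparency false in
/-- `χ ↦ cyclotomicCharacterOf χ` (Dirichlet characters mod `M` ↦ characters of
`Gal(ℚ(ζ_M)/ℚ)`) is injective: `Gal(ℚ(ζ_M)/ℚ) ≅ (ℤ/M)ˣ` and a Dirichlet character is determined
by its restriction to units. [folklore] -/
theorem cyclotomicCharacterOf_injective {M : ℕ} [NeZero M] :
    Function.Injective
      (fun χ : DirichletCharacter ℂ M => cyclotomicCharacterOf χ) := by
  intro χ₁ χ₂ h
  have h' : χ₁.toUnitHom = χ₂.toUnitHom :=
    (MonoidHom.cancel_right (IsCyclotomicExtension.autEquivPow (CyclotomicField M ℚ)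
      (cyclotomic.irreducible_rat (NeZero.pos M))).surjective).mp h
  rwa [MulChar.toUnitHom_eq, MulChar.toUnitHom_eq, Equiv.apply_eq_iff_eq] at h'

set_option backward.isDefEq.respectTransparency false in
/-- **Existence of the inflated Dirichlet character** (Kato's identification
`(ℤ/M)ˣ ≅ Gal(ℚ(ζ_M)/ℚ) → Gal(K/ℚ) → ℂˣ`, p. 235). For an embedding `ι : K → ℚ(ζ_M)` and a
character `ψ` of `Aut(K/ℚ)` there is a Dirichlet character `χ` mod `M` with
`χ(σ) = ψ(σ|_K)` — precisely: `cyclotomicCharacterOf χ σ = ψ τ` whenever `σ ∘ ι = ι ∘ τ`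
(`K/ℚ` is automatically normal, so every `σ` has such a `τ`, unique). [folklore] -/
theorem exists_dirichletCharacter_inflating {M : ℕ} [NeZero M]
    (ι : K →ₐ[ℚ] CyclotomicField M ℚ) (ψ : (K ≃ₐ[ℚ] K) →* ℂˣ) :
    ∃ χ : DirichletCharacter ℂ M,
      ∀ (σ : CyclotomicField M ℚ ≃ₐ[ℚ] CyclotomicField M ℚ) (τ : K ≃ₐ[ℚ] K),
        (∀ x, σ (ι x) = ι (τ x)) → (cyclotomicCharacterOf χ σ : ℂ) = ψ τ := by
  haveI : IsAbelianGalois ℚ K := isAbelianGalois_of_algHom_cyclotomic ι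
  obtain ⟨r, hr⟩ := exists_monoidHom_restrict_of_normal ι
  obtain ⟨χ, hχ⟩ := exists_cyclotomicCharacterOf_eq (ψ.comp r)
  refine ⟨χ, fun σ τ h => ?_⟩
  have hτ : τ = r σ := algEquiv_eq_of_comp_eq ι h (hr σ)
  rw [hχ, hτ, MonoidHom.comp_apply]

set_option backward.isDefEq.respectTransparency false in
/-- **Uniqueness of the inflated Dirichlet character**: two Dirichlet characters mod `M`
inflating the same function `ψ` on `Aut(K/ℚ)` along `ι` coincide (every `σ ∈ Gal(ℚ(ζ_M)/ℚ)`
restricts to `K`, and `cyclotomicCharacterOf` is injective). [folklore] -/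
theorem dirichletCharacter_inflating_unique {M : ℕ} [NeZero M]
    (ι : K →ₐ[ℚ] CyclotomicField M ℚ) (ψ : (K ≃ₐ[ℚ] K) → ℂ) {χ₁ χ₂ : DirichletCharacter ℂ M}
    (h₁ : ∀ (σ : CyclotomicField M ℚ ≃ₐ[ℚ] CyclotomicField M ℚ) (τ : K ≃ₐ[ℚ] K),
      (∀ x, σ (ι x) = ι (τ x)) → (cyclotomicCharacterOf χ₁ σ : ℂ) = ψ τ)
    (h₂ : ∀ (σ : CyclotomicField M ℚ ≃ₐ[ℚ] CyclotomicField M ℚ) (τ : K ≃ₐ[ℚ] K),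
      (∀ x, σ (ι x) = ι (τ x)) → (cyclotomicCharacterOf χ₂ σ : ℂ) = ψ τ) :
    χ₁ = χ₂ := by
  haveI : IsAbelianGalois ℚ K := isAbelianGalois_of_algHom_cyclotomic ι
  apply cyclotomicCharacterOf_injective
  refine MonoidHom.ext fun σ => Units.ext ?_
  obtain ⟨τ, hτ⟩ := exists_algEquiv_comp_eq_of_normal ι σ
  change (cyclotomicCharacterOf χ₁ σ : ℂ) = cyclotomicCharacterOf χ₂ σ
  rw [h₁ σ τ hτ, h₂ σ τ hτ]

set_option backward.isDefEq.respectTransparency false in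
/-- **Level raising.** If `χ` mod `m` inflates `ψ` along `ι : K → ℚ(ζ_m)` and
`j : ℚ(ζ_m) → ℚ(ζ_M)` (`m ∣ M`), then the inflation `changeLevel χ` mod `M` inflates `ψ` along
`j ∘ ι` (`cyclotomicCharacterOf_changeLevel_eq_restrictNormal`). [folklore] -/
theorem inflating_changeLevel {m M : ℕ} [NeZero m] [NeZero M] (hd : m ∣ M)
    (ι : K →ₐ[ℚ] CyclotomicField m ℚ) (j : CyclotomicField m ℚ →ₐ[ℚ] CyclotomicField M ℚ)
    (ψ : (K ≃ₐ[ℚ] K) → ℂ) {χ : DirichletCharacter ℂ m}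
    (h : ∀ (σ : CyclotomicField m ℚ ≃ₐ[ℚ] CyclotomicField m ℚ) (τ : K ≃ₐ[ℚ] K),
      (∀ x, σ (ι x) = ι (τ x)) → (cyclotomicCharacterOf χ σ : ℂ) = ψ τ)
    (σ : CyclotomicField M ℚ ≃ₐ[ℚ] CyclotomicField M ℚ) (τ : K ≃ₐ[ℚ] K)
    (hστ : ∀ x, σ (j (ι x)) = j (ι (τ x))) :
    (cyclotomicCharacterOf (DirichletCharacter.changeLevel hd χ) σ : ℂ) = ψ τ := by
  letI : Algebra (CyclotomicField m ℚ) (CyclotomicField M ℚ) := j.toRingHom.toAlgebra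
  haveI : IsScalarTower ℚ (CyclotomicField m ℚ) (CyclotomicField M ℚ) :=
    IsScalarTower.of_algebraMap_eq fun x => (j.commutes x).symm
  haveI : IsGalois ℚ (CyclotomicField m ℚ) := IsCyclotomicExtension.isGalois {m} ℚ _
  rw [cyclotomicCharacterOf_changeLevel_eq_restrictNormal hd j σ χ]
  refine h _ τ fun x => (j : CyclotomicField m ℚ →+* CyclotomicField M ℚ).injective ?_
  change j ((σ.restrictNormal (CyclotomicField m ℚ)) (ι x)) = j (ι (τ x))
  rw [← hστ x]
  exact AlgEquiv.restrictNormal_commutes σ (CyclotomicField m ℚ) (ι x)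

set_option backward.isDefEq.respectTransparency false in
/-- **Independence of the embedding.** Two embeddings `ι₁, ι₂ : K → ℚ(ζ_M)` induce the SAME
Dirichlet character of `ψ`: `ι₂ = σ₀ ∘ ι₁` for some `σ₀ ∈ Gal(ℚ(ζ_M)/ℚ)`
(`exists_algEquiv_comp_algHom_eq`), and since `Gal(ℚ(ζ_M)/ℚ)` is abelian the restrictions of
any `σ` along `ι₁` and along `ι₂` coincide (`σ ι₂ = σ σ₀ ι₁ = σ₀ σ ι₁ = σ₀ ι₁ τ = ι₂ τ`).
[folklore] -/
theorem eq_of_inflating_of_algHom {M : ℕ} [NeZero M]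
    (ι₁ ι₂ : K →ₐ[ℚ] CyclotomicField M ℚ) (ψ : (K ≃ₐ[ℚ] K) → ℂ) {χ₁ χ₂ : DirichletCharacter ℂ M}
    (h₁ : ∀ (σ : CyclotomicField M ℚ ≃ₐ[ℚ] CyclotomicField M ℚ) (τ : K ≃ₐ[ℚ] K),
      (∀ x, σ (ι₁ x) = ι₁ (τ x)) → (cyclotomicCharacterOf χ₁ σ : ℂ) = ψ τ)
    (h₂ : ∀ (σ : CyclotomicField M ℚ ≃ₐ[ℚ] CyclotomicField M ℚ) (τ : K ≃ₐ[ℚ] K),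
      (∀ x, σ (ι₂ x) = ι₂ (τ x)) → (cyclotomicCharacterOf χ₂ σ : ℂ) = ψ τ) :
    χ₁ = χ₂ := by
  haveI : IsAbelianGalois ℚ K := isAbelianGalois_of_algHom_cyclotomic ι₁
  haveI : IsGalois ℚ (CyclotomicField M ℚ) := IsCyclotomicExtension.isGalois {M} ℚ _
  have hcomm := (IsCyclotomicExtension.isMulCommutative {M} ℚ (CyclotomicField M ℚ)).is_comm
  obtain ⟨σ₀, hσ₀⟩ := exists_algEquiv_comp_algHom_eq ι₁ ι₂
  refine dirichletCharacter_inflating_unique ι₁ ψ h₁ fun σ τ hτ => h₂ σ τ fun x => ?_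
  rw [← hσ₀, ← hσ₀, ← hτ x, ← AlgEquiv.mul_apply, hcomm.comm σ σ₀, AlgEquiv.mul_apply]

set_option backward.isDefEq.respectTransparency false in
/-- **Independence of the level.** If `χ₁` mod `m₁` inflates `ψ` along `ι₁ : K → ℚ(ζ_{m₁})` and
`χ₂` mod `m₂` inflates `ψ` along `ι₂ : K → ℚ(ζ_{m₂})`, then `χ₁` and `χ₂` have the same
inflation mod `m₁ m₂` (both inflate `ψ` along embeddings into `ℚ(ζ_{m₁ m₂})`, level raising
plus independence of the embedding); in particular they have the same primitive character.
[folklore] -/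
theorem changeLevel_mul_eq_changeLevel_mul_of_inflating {m₁ m₂ : ℕ} [NeZero m₁] [NeZero m₂]
    (ι₁ : K →ₐ[ℚ] CyclotomicField m₁ ℚ) (ι₂ : K →ₐ[ℚ] CyclotomicField m₂ ℚ)
    (ψ : (K ≃ₐ[ℚ] K) → ℂ) {χ₁ : DirichletCharacter ℂ m₁} {χ₂ : DirichletCharacter ℂ m₂}
    (h₁ : ∀ (σ : CyclotomicField m₁ ℚ ≃ₐ[ℚ] CyclotomicField m₁ ℚ) (τ : K ≃ₐ[ℚ] K),
      (∀ x, σ (ι₁ x) = ι₁ (τ x)) → (cyclotomicCharacterOf χ₁ σ : ℂ) = ψ τ)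
    (h₂ : ∀ (σ : CyclotomicField m₂ ℚ ≃ₐ[ℚ] CyclotomicField m₂ ℚ) (τ : K ≃ₐ[ℚ] K),
      (∀ x, σ (ι₂ x) = ι₂ (τ x)) → (cyclotomicCharacterOf χ₂ σ : ℂ) = ψ τ) :
    DirichletCharacter.changeLevel (Dvd.intro m₂ rfl : m₁ ∣ m₁ * m₂) χ₁ =
      DirichletCharacter.changeLevel (Dvd.intro_left m₁ rfl : m₂ ∣ m₁ * m₂) χ₂ := by
  haveI : NeZero (m₁ * m₂) := ⟨mul_ne_zero (NeZero.ne m₁) (NeZero.ne m₂)⟩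
  obtain ⟨j₁⟩ := nonempty_algHom_cyclotomicField_of_dvd (Dvd.intro m₂ rfl : m₁ ∣ m₁ * m₂)
  obtain ⟨j₂⟩ := nonempty_algHom_cyclotomicField_of_dvd (Dvd.intro_left m₁ rfl : m₂ ∣ m₁ * m₂)
  refine eq_of_inflating_of_algHom (j₁.comp ι₁) (j₂.comp ι₂) ψ (fun σ τ hστ => ?_)
    (fun σ τ hστ => ?_)
  · exact inflating_changeLevel _ ι₁ j₁ ψ h₁ σ τ fun x => by simpa using hστ x
  · exact inflating_changeLevel _ ι₂ j₂ ψ h₂ σ τ fun x => by simpa using hστ x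

end Inflation

/-! ### §2'. Kato's hypothesis `L(E, ψ, 1) ≠ 0` does not depend on the normalisation -/

section Hypothesis

open ModularForms

variable {K : Type*} [Field K] [Algebra ℚ K]

set_option backward.isDefEq.respectTransparency false in
/-- **`L(E, ψ, 1) ≠ 0` is well defined.** Let `E/ℚ` be an elliptic curve with newform `f`
(`IsNewformOf W f`) and `ψ` a function on `Aut(K/ℚ)`. For two data `(m₁, ι₁, χ₁)`,
`(m₂, ι₂, χ₂)` — embeddings `ιᵢ : K → ℚ(ζ_{mᵢ})` and Dirichlet characters `χᵢ` mod `mᵢ`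
inflating `ψ` — the mod-`m₁` series `∑ χ₁(n) aₙ(f) n⁻ˢ = L_{prime(m₁)}(f, ψ, s)` has an entire
continuation non-vanishing at `s = 1` iff the mod-`m₂` series has: both are equivalent to the
statement for the common inflation mod `m₁ m₂`
(`changeLevel_mul_eq_changeLevel_mul_of_inflating`), the removed Euler factors being entire and
non-zero at `1` (`exists_continuation_changeLevel_iff`, Hasse bound). In particular Kato's
normalisation (least `m` with `K ⊂ ℚ(ζ_m)`, `S = prime(m)`, p. 235) and any other admissible
one give the same hypothesis. [cite: Kato2004Asterisque, §14 remark after Thm. 14.2 (p. 235)] -/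
theorem exists_continuation_iff_of_inflating {W : WeierstrassCurve ℚ} [W.IsElliptic] {N : ℕ}
    [NeZero N] {f : CuspForm (Gamma0 N) 2} (hf : IsNewformOf W f) {m₁ m₂ : ℕ} [NeZero m₁]
    [NeZero m₂] (ι₁ : K →ₐ[ℚ] CyclotomicField m₁ ℚ) (ι₂ : K →ₐ[ℚ] CyclotomicField m₂ ℚ)
    (ψ : (K ≃ₐ[ℚ] K) → ℂ) {χ₁ : DirichletCharacter ℂ m₁} {χ₂ : DirichletCharacter ℂ m₂}
    (h₁ : ∀ (σ : CyclotomicField m₁ ℚ ≃ₐ[ℚ] CyclotomicField m₁ ℚ) (τ : K ≃ₐ[ℚ] K),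
      (∀ x, σ (ι₁ x) = ι₁ (τ x)) → (cyclotomicCharacterOf χ₁ σ : ℂ) = ψ τ)
    (h₂ : ∀ (σ : CyclotomicField m₂ ℚ ≃ₐ[ℚ] CyclotomicField m₂ ℚ) (τ : K ≃ₐ[ℚ] K),
      (∀ x, σ (ι₂ x) = ι₂ (τ x)) → (cyclotomicCharacterOf χ₂ σ : ℂ) = ψ τ) :
    (∃ L : ℂ → ℂ, Differentiable ℂ L ∧
      (∀ s : ℂ, 2 < s.re → L s = twistedLSeries f χ₁ s) ∧ L 1 ≠ 0) ↔
    (∃ L : ℂ → ℂ, Differentiable ℂ L ∧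
      (∀ s : ℂ, 2 < s.re → L s = twistedLSeries f χ₂ s) ∧ L 1 ≠ 0) := by
  haveI : NeZero (m₁ * m₂) := ⟨mul_ne_zero (NeZero.ne m₁) (NeZero.ne m₂)⟩
  rw [← exists_continuation_changeLevel_iff hf (Dvd.intro m₂ rfl : m₁ ∣ m₁ * m₂) χ₁,
    ← exists_continuation_changeLevel_iff hf (Dvd.intro_left m₁ rfl : m₂ ∣ m₁ * m₂) χ₂,
    changeLevel_mul_eq_changeLevel_mul_of_inflating ι₁ ι₂ ψ h₁ h₂]

end Hypothesis

/-! ### §3. Every character of `Gal(K/ℚ)`, `K/ℚ` finite abelian, has a datum (Kronecker–Weber) -/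

section Datum

set_option backward.isDefEq.respectTransparency false in
/-- **Existence of Kato's datum.** For a finite abelian extension `K/ℚ` and a character `ψ` of
`Gal(K/ℚ)` there are `M ≥ 1`, an embedding `ι : K → ℚ(ζ_M)` (Kronecker–Weber, proved in the
tree: `KroneckerWeber_holds`, through `exists_algHom_cyclotomicField_of_isAbelianGalois`) and a
Dirichlet character `χ` mod `M` inflating `ψ` (`exists_dirichletCharacter_inflating`) — the
identification "`(ℤ/m)ˣ ≅ Gal(ℚ(ζ_m)/ℚ) → Gal(K/ℚ) → ℂˣ`" of Kato, p. 235, for SOME admissible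
`m` (by `exists_continuation_iff_of_inflating` the resulting hypothesis does not depend on the
choice). [cite: Washington1997, Ch. 14, Thm. 14.1] -/
theorem exists_inflating_datum (K : Type*) [Field K] [Algebra ℚ K] [FiniteDimensional ℚ K]
    [IsAbelianGalois ℚ K] (ψ : (K ≃ₐ[ℚ] K) →* ℂˣ) :
    ∃ (M : ℕ) (_ : NeZero M) (ι : K →ₐ[ℚ] CyclotomicField M ℚ) (χ : DirichletCharacter ℂ M),
      ∀ (σ : CyclotomicField M ℚ ≃ₐ[ℚ] CyclotomicField M ℚ) (τ : K ≃ₐ[ℚ] K),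
        (∀ x, σ (ι x) = ι (τ x)) → (cyclotomicCharacterOf χ σ : ℂ) = ψ τ := by
  obtain ⟨M, hM, ⟨ι⟩⟩ :=
    GaloisRepresentations.exists_neZero_algHom_cyclotomicField_of_isAbelianGalois K
  obtain ⟨χ, hχ⟩ := exists_dirichletCharacter_inflating ι ψ
  exact ⟨M, hM, ι, χ, hχ⟩

end Datum


/-! ### §3'. Dictionary: characters of `Gal(K/ℚ)` = Dirichlet characters trivial on `Gal(ℚ(ζ_M)/K)` -/

section Dictionary

variable {K : Type*} [Field K] [Algebra ℚ K]

set_option backward.isDefEq.respectTransparency false in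
/-- The Dirichlet character inflating a character `ψ` of `Aut(K/ℚ)` along `ι : K → ℚ(ζ_M)` is
trivial on the automorphisms of `ℚ(ζ_M)` fixing `ι(K)` pointwise (they restrict to the identity
of `K`). [folklore] -/
theorem cyclotomicCharacterOf_eq_one_of_inflating {M : ℕ} [NeZero M]
    (ι : K →ₐ[ℚ] CyclotomicField M ℚ) (ψ : (K ≃ₐ[ℚ] K) →* ℂˣ) {χ : DirichletCharacter ℂ M}
    (hχ : ∀ (σ : CyclotomicField M ℚ ≃ₐ[ℚ] CyclotomicField M ℚ) (τ : K ≃ₐ[ℚ] K),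
      (∀ x, σ (ι x) = ι (τ x)) → (cyclotomicCharacterOf χ σ : ℂ) = ψ τ)
    {σ : CyclotomicField M ℚ ≃ₐ[ℚ] CyclotomicField M ℚ} (hσ : ∀ x, σ (ι x) = ι x) :
    cyclotomicCharacterOf χ σ = 1 :=
  Units.ext (by rw [hχ σ 1 fun x => by rw [hσ x, AlgEquiv.one_apply], map_one, Units.val_one])

set_option backward.isDefEq.respectTransparency false in
/-- **Conversely, a Dirichlet character mod `M` trivial on `Gal(ℚ(ζ_M)/ι(K))` is inflated from a
(unique) character of `Gal(K/ℚ)`**: restriction `Gal(ℚ(ζ_M)/ℚ) → Gal(K/ℚ)` along `ι` is a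
surjective homomorphism (`exists_algEquiv_extend_of_normal`) whose kernel consists of the
automorphisms fixing `ι(K)` pointwise, so `cyclotomicCharacterOf χ` factors through it (Mathlib
`MonoidHom.liftOfSurjective`). Together with `exists_dirichletCharacter_inflating` and
`cyclotomicCharacterOf_eq_one_of_inflating`: the characters of `Gal(K/ℚ)` correspond exactly to
the Dirichlet characters mod `M` trivial on `Gal(ℚ(ζ_M)/K)` — the form in which the tree's
`H`-relative statements (`KatoTwistedFinitenessIsotypicProofs.lean`) are phrased. [folklore] -/
theorem exists_monoidHom_inflating_of_cyclotomicCharacterOf_eq_one {M : ℕ} [NeZero M]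
    (ι : K →ₐ[ℚ] CyclotomicField M ℚ) {χ : DirichletCharacter ℂ M}
    (hχ : ∀ σ : CyclotomicField M ℚ ≃ₐ[ℚ] CyclotomicField M ℚ, (∀ x, σ (ι x) = ι x) →
      cyclotomicCharacterOf χ σ = 1) :
    ∃ ψ : (K ≃ₐ[ℚ] K) →* ℂˣ,
      ∀ (σ : CyclotomicField M ℚ ≃ₐ[ℚ] CyclotomicField M ℚ) (τ : K ≃ₐ[ℚ] K),
        (∀ x, σ (ι x) = ι (τ x)) → (cyclotomicCharacterOf χ σ : ℂ) = ψ τ := by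
  haveI : IsAbelianGalois ℚ K := isAbelianGalois_of_algHom_cyclotomic ι
  haveI : IsGalois ℚ (CyclotomicField M ℚ) := IsCyclotomicExtension.isGalois {M} ℚ _
  obtain ⟨r, hr⟩ := exists_monoidHom_restrict_of_normal ι
  have hsurj : Function.Surjective r := fun τ => by
    obtain ⟨σ, hσ⟩ := exists_algEquiv_extend_of_normal ι τ
    exact ⟨σ, (algEquiv_eq_of_comp_eq ι (hr σ) hσ)⟩
  have hker : r.ker ≤ (cyclotomicCharacterOf χ).ker := fun σ hσ => by
    rw [MonoidHom.mem_ker] at hσ ⊢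
    refine hχ σ fun x => ?_
    rw [hr σ x, hσ, AlgEquiv.one_apply]
  refine ⟨r.liftOfSurjective hsurj ⟨cyclotomicCharacterOf χ, hker⟩, fun σ τ hστ => ?_⟩
  have hτ : τ = r σ := algEquiv_eq_of_comp_eq ι hστ (hr σ)
  rw [hτ, MonoidHom.liftOfSurjective, MonoidHom.liftOfRightInverse_comp_apply]

end Dictionary

/-! ### §4. Kato, Cor. 14.3 (2), over an arbitrary finite abelian extension of `ℚ` -/

section Kato

open ModularForms

variable {K : Type*} [Field K] [Algebra ℚ K]

set_option backward.isDefEq.respectTransparency false in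
open scoped Classical in
/-- **Kato's Cor. 14.3 (2) for an elliptic curve over an arbitrary finite abelian extension
`K/ℚ`** (K. Kato, Astérisque 295 (2004), Cor. 14.3 (2), p. 235), from the vendored fact
`kato_finite_chiPart_of_twistedLValue_ne_zero` (the case `K = ℚ(ζ_m)`; hypothesis `hK`, NOT
proved in the tree — an Euler-system theorem). Let `E/ℚ` be an elliptic curve with newform
`f ∈ S₂(Γ₀(N))` (`IsNewformOf W f`; so `E` is a quotient of `J₀(N)`, hence of `J₁(N)`, and
`L(E, ·, s) = L(f, ·, s)`), `K` a field with an embedding `ι : K → ℚ(ζ_M)` (then `K/ℚ` is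
finite abelian, and conversely every finite abelian `K/ℚ` has one by Kronecker–Weber,
`exists_inflating_datum`), `ψ` a function on `Gal(K/ℚ)` and `χ` a Dirichlet character mod `M`
inflating it (`χ(σ) = ψ(σ|_K)`, i.e. `ψ` IS Kato's composite
`(ℤ/M)ˣ ≅ Gal(ℚ(ζ_M)/ℚ) → Gal(K/ℚ) → ℂ`). If the mod-`M` twisted series
`∑ χ(n) aₙ(f) n⁻ˢ = L_{prime(M)}(f, ψ, s)` (`re s > 2`) has an entire continuation `L` with
`L(1) ≠ 0` — Kato's hypothesis "`L(E, ψ, 1) ≠ 0`", independent of the choice of `(M, ι)` by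
`exists_continuation_iff_of_inflating` — then the `ψ`-part
`E(K)^(ψ) = {P ∈ E(K) ; I_ψ · P = 0}` of the Mordell–Weil group (action `τ ↦ Point.map τ`) is
finite. Proof: the vendored fact, in its all-moduli form
`kato_finite_chiPart_cyclotomic_of_twistedLValue_ne_zero_of`, gives `E(ℚ(ζ_M))^(χ)` finite, and
`Point.map ι : E(K) → E(ℚ(ζ_M))` is an injective homomorphism intertwining `σ|_K` with `σ`, so
`E(K)^(ψ)` embeds into `E(ℚ(ζ_M))^(χ)` (`finite_chiPart_of_equivariant`; Kato, p. 237, §14.6,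
reduces Thm. 14.2 over `K` to `ℚ` by the Selmer-group analogue `Sel(K, T) = Sel(ℚ, T ⊗ ℤ[G])`).
[cite: Kato2004Asterisque, Cor. 14.3 (2) (p. 235)] -/
theorem kato_finite_chiPart_abelianField_of_twistedLValue_ne_zero
    (hK : kato_finite_chiPart_of_twistedLValue_ne_zero) (W : WeierstrassCurve ℚ) [W.IsElliptic]
    {N : ℕ} [NeZero N] {f : CuspForm (Gamma0 N) 2} (hf : IsNewformOf W f)
    (ψ : (K ≃ₐ[ℚ] K) → ℂ) {M : ℕ} [NeZero M] (ι : K →ₐ[ℚ] CyclotomicField M ℚ)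
    (χ : DirichletCharacter ℂ M)
    (hχ : ∀ (σ : CyclotomicField M ℚ ≃ₐ[ℚ] CyclotomicField M ℚ) (τ : K ≃ₐ[ℚ] K),
      (∀ x, σ (ι x) = ι (τ x)) → (cyclotomicCharacterOf χ σ : ℂ) = ψ τ)
    (hL : ∃ L : ℂ → ℂ, Differentiable ℂ L ∧
      (∀ s : ℂ, 2 < s.re → L s = twistedLSeries f χ s) ∧ L 1 ≠ 0) :
    Finite (chiPart (fun τ : K ≃ₐ[ℚ] K => Point.map (W' := W.toAffine) (τ : K →ₐ[ℚ] K)) ψ) := by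
  haveI : IsAbelianGalois ℚ K := isAbelianGalois_of_algHom_cyclotomic ι
  obtain ⟨r, hr⟩ := exists_monoidHom_restrict_of_normal ι
  refine finite_chiPart_of_equivariant r (Point.map (W' := W.toAffine) ι) (Point.map_injective ι)
    (fun σ P => ?_) (fun σ => hχ σ (r σ) (hr σ))
    (kato_finite_chiPart_cyclotomic_of_twistedLValue_ne_zero_of hK W hf χ hL)
  have hφ : (σ : CyclotomicField M ℚ →ₐ[ℚ] CyclotomicField M ℚ).comp ι =
      ι.comp (r σ : K →ₐ[ℚ] K) :=
    AlgHom.ext fun x => hr σ x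
  rw [Point.map_map, Point.map_map, hφ]

set_option backward.isDefEq.respectTransparency false in
open scoped Classical in
/-- `∃`-datum form of `kato_finite_chiPart_abelianField_of_twistedLValue_ne_zero`: if SOME datum
`(M, ι, χ)` of `ψ` has `L_{prime(M)}(f, ψ, 1) ≠ 0` (continued), then `E(K)^(ψ)` is finite.
[cite: Kato2004Asterisque, Cor. 14.3 (2) (p. 235)] -/
theorem kato_finite_chiPart_abelianField_of_exists
    (hK : kato_finite_chiPart_of_twistedLValue_ne_zero) (W : WeierstrassCurve ℚ) [W.IsElliptic]
    {N : ℕ} [NeZero N] {f : CuspForm (Gamma0 N) 2} (hf : IsNewformOf W f)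
    (ψ : (K ≃ₐ[ℚ] K) → ℂ)
    (hL : ∃ (M : ℕ) (_ : NeZero M) (ι : K →ₐ[ℚ] CyclotomicField M ℚ)
      (χ : DirichletCharacter ℂ M),
      (∀ (σ : CyclotomicField M ℚ ≃ₐ[ℚ] CyclotomicField M ℚ) (τ : K ≃ₐ[ℚ] K),
        (∀ x, σ (ι x) = ι (τ x)) → (cyclotomicCharacterOf χ σ : ℂ) = ψ τ) ∧
      ∃ L : ℂ → ℂ, Differentiable ℂ L ∧
        (∀ s : ℂ, 2 < s.re → L s = twistedLSeries f χ s) ∧ L 1 ≠ 0) :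
    Finite (chiPart (fun τ : K ≃ₐ[ℚ] K => Point.map (W' := W.toAffine) (τ : K →ₐ[ℚ] K)) ψ) := by
  obtain ⟨M, hM, ι, χ, hχ, hL⟩ := hL
  exact kato_finite_chiPart_abelianField_of_twistedLValue_ne_zero hK W hf ψ ι χ hχ hL

set_option backward.isDefEq.respectTransparency false in
/-- **"For every datum" versus "for some datum".** For a finite abelian `K/ℚ`, a character `ψ`
of `Gal(K/ℚ)` and the newform `f` of an elliptic curve over `ℚ`, the hypothesis
"`L_{prime(M)}(f, χ, 1) ≠ 0` for EVERY datum `(M, ι, χ)` of `ψ`" is equivalent to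
"for SOME datum": a datum exists (`exists_inflating_datum`, Kronecker–Weber) and any two give
equivalent hypotheses (`exists_continuation_iff_of_inflating`). Either is Kato's
"`L(E, ψ, 1) ≠ 0`". [cite: Kato2004Asterisque, §14 remark after Thm. 14.2 (p. 235)] -/
theorem forall_inflating_iff_exists_inflating (K : Type*) [Field K] [Algebra ℚ K]
    [FiniteDimensional ℚ K] [IsAbelianGalois ℚ K] {W : WeierstrassCurve ℚ} [W.IsElliptic]
    {N : ℕ} [NeZero N] {f : CuspForm (Gamma0 N) 2} (hf : IsNewformOf W f)
    (ψ : (K ≃ₐ[ℚ] K) →* ℂˣ) :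
    (∀ {M : ℕ} [NeZero M] (ι : K →ₐ[ℚ] CyclotomicField M ℚ) (χ : DirichletCharacter ℂ M),
      (∀ (σ : CyclotomicField M ℚ ≃ₐ[ℚ] CyclotomicField M ℚ) (τ : K ≃ₐ[ℚ] K),
        (∀ x, σ (ι x) = ι (τ x)) → (cyclotomicCharacterOf χ σ : ℂ) = ψ τ) →
      ∃ L : ℂ → ℂ, Differentiable ℂ L ∧
        (∀ s : ℂ, 2 < s.re → L s = twistedLSeries f χ s) ∧ L 1 ≠ 0) ↔
    (∃ (M : ℕ) (_ : NeZero M) (ι : K →ₐ[ℚ] CyclotomicField M ℚ)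
      (χ : DirichletCharacter ℂ M),
      (∀ (σ : CyclotomicField M ℚ ≃ₐ[ℚ] CyclotomicField M ℚ) (τ : K ≃ₐ[ℚ] K),
        (∀ x, σ (ι x) = ι (τ x)) → (cyclotomicCharacterOf χ σ : ℂ) = ψ τ) ∧
      ∃ L : ℂ → ℂ, Differentiable ℂ L ∧
        (∀ s : ℂ, 2 < s.re → L s = twistedLSeries f χ s) ∧ L 1 ≠ 0) := by
  obtain ⟨M₀, hM₀, ι₀, χ₀, hχ₀⟩ := exists_inflating_datum K ψ
  constructor
  · intro h
    exact ⟨M₀, hM₀, ι₀, χ₀, hχ₀, h ι₀ χ₀ hχ₀⟩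
  · rintro ⟨M, hM, ι, χ, hχ, hL⟩ M' _ ι' χ' hχ'
    exact (exists_continuation_iff_of_inflating hf ι ι' (fun τ => (ψ τ : ℂ)) hχ hχ').mp hL

set_option backward.isDefEq.respectTransparency false in
open scoped Classical in
/-- **Kato, Cor. 14.3 (2), as printed, for elliptic curves** (Astérisque 295, p. 235): "Let `K`
be a finite abelian extension of `ℚ`, let `χ : Gal(K/ℚ) → ℂˣ` be a character, and assume
`L(A, χ, 1) ≠ 0`. Then […] (2) the `χ`-part `A(K)^(χ)` is finite" — here for `A = E` an
elliptic curve over `ℚ` with newform `f` (`IsNewformOf W f`), `K` an ABSTRACT finite abelian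
extension of `ℚ` (`FiniteDimensional ℚ K`, `IsAbelianGalois ℚ K`), `ψ : Gal(K/ℚ) →* ℂˣ`, the
Galois action `τ ↦ Point.map τ` on `E(K)`, and Kato's hypothesis spelled normalisation-free:
for every identification of `ψ` with a Dirichlet character `χ` mod `M` along an embedding
`K ⊂ ℚ(ζ_M)` (such data exist by Kronecker–Weber, `exists_inflating_datum`, and all give the
same condition, `forall_inflating_iff_exists_inflating`; Kato uses the least such `M`), the
series `L_{prime(M)}(f, χ, s)` has an entire continuation with `L(1) ≠ 0`. Modulo the vendored
fact `kato_finite_chiPart_of_twistedLValue_ne_zero` (`hK`, Kato's theorem over `ℚ(ζ_M)`, NOT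
proved in the tree) this is `kato_finite_chiPart_abelianField_of_twistedLValue_ne_zero` at a
datum supplied by `exists_inflating_datum`. [cite: Kato2004Asterisque, Cor. 14.3 (2) (p. 235)] -/
theorem kato_finite_chiPart_of_isAbelianGalois_of_twistedLValue_ne_zero
    (hK : kato_finite_chiPart_of_twistedLValue_ne_zero) (K : Type*) [Field K] [Algebra ℚ K]
    [FiniteDimensional ℚ K] [IsAbelianGalois ℚ K] (W : WeierstrassCurve ℚ) [W.IsElliptic]
    {N : ℕ} [NeZero N] {f : CuspForm (Gamma0 N) 2} (hf : IsNewformOf W f)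
    (ψ : (K ≃ₐ[ℚ] K) →* ℂˣ)
    (hL : ∀ {M : ℕ} [NeZero M] (ι : K →ₐ[ℚ] CyclotomicField M ℚ) (χ : DirichletCharacter ℂ M),
      (∀ (σ : CyclotomicField M ℚ ≃ₐ[ℚ] CyclotomicField M ℚ) (τ : K ≃ₐ[ℚ] K),
        (∀ x, σ (ι x) = ι (τ x)) → (cyclotomicCharacterOf χ σ : ℂ) = ψ τ) →
      ∃ L : ℂ → ℂ, Differentiable ℂ L ∧
        (∀ s : ℂ, 2 < s.re → L s = twistedLSeries f χ s) ∧ L 1 ≠ 0) :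
    Finite (chiPart (fun τ : K ≃ₐ[ℚ] K => Point.map (W' := W.toAffine) (τ : K →ₐ[ℚ] K))
      (fun τ => (ψ τ : ℂ))) := by
  obtain ⟨M, hM, ι, χ, hχ⟩ := exists_inflating_datum K ψ
  exact kato_finite_chiPart_abelianField_of_twistedLValue_ne_zero hK W hf (fun τ => (ψ τ : ℂ))
    ι χ hχ (hL ι χ hχ)

end Kato


/-! ### §5. All twisted `L`-values non-zero: torsion and finiteness of `E(K)` -/

section Consequences

open ModularForms
open scoped IsMulCommutative

set_option backward.isDefEq.respectTransparency false in
open scoped Classical in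
/-- **Points fixed by `H ⊂ Gal(K/ℚ)` are torsion when no `L(E, ψ, 1)`, `ψ` trivial on `H`,
vanishes** — Cor. 14.3 (2) over the abstract finite abelian `K` summed over the characters trivial
on `H` (under the vendored fact `hK`): the `ψ`-parts for those `ψ` exhaust the `H`-fixed part of
`E(K)` up to bounded torsion (`isOfFinAddOrder_of_forall_finite_chiPart`,
`KatoTwistedFinitenessIsotypicProofs.lean`, Kato's remark p. 236), and each is finite by
`kato_finite_chiPart_of_isAbelianGalois_of_twistedLValue_ne_zero`. With `H = Gal(K/K₀)` this is
the statement "`E(K₀)` is torsion" for every subfield `K₀ ⊂ K`.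
[cite: Kato2004Asterisque, Cor. 14.3 (2) (p. 235) and remark p. 236] -/
theorem isOfFinAddOrder_point_of_isAbelianGalois_of_kato
    (hK : kato_finite_chiPart_of_twistedLValue_ne_zero) (K : Type*) [Field K] [Algebra ℚ K]
    [FiniteDimensional ℚ K] [IsAbelianGalois ℚ K] (W : WeierstrassCurve ℚ) [W.IsElliptic]
    {N : ℕ} [NeZero N] {f : CuspForm (Gamma0 N) 2} (hf : IsNewformOf W f)
    (H : Set (K ≃ₐ[ℚ] K))
    (hL : ∀ ψ : (K ≃ₐ[ℚ] K) →* ℂˣ, (∀ h ∈ H, ψ h = 1) →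
      ∀ {M : ℕ} [NeZero M] (ι : K →ₐ[ℚ] CyclotomicField M ℚ) (χ : DirichletCharacter ℂ M),
        (∀ (σ : CyclotomicField M ℚ ≃ₐ[ℚ] CyclotomicField M ℚ) (τ : K ≃ₐ[ℚ] K),
          (∀ x, σ (ι x) = ι (τ x)) → (cyclotomicCharacterOf χ σ : ℂ) = ψ τ) →
        ∃ L : ℂ → ℂ, Differentiable ℂ L ∧
          (∀ s : ℂ, 2 < s.re → L s = twistedLSeries f χ s) ∧ L 1 ≠ 0)
    {P : (W.baseChange K).toAffine.Point}
    (hP : ∀ h ∈ H, Point.map (W' := W.toAffine) (h : K →ₐ[ℚ] K) P = P) :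
    IsOfFinAddOrder P := by
  haveI : IsMulCommutative (K ≃ₐ[ℚ] K) := IsAbelianGalois.toIsMulCommutative
  refine isOfFinAddOrder_of_forall_finite_chiPart (G := K ≃ₐ[ℚ] K)
    (fun τ => Point.map (W' := W.toAffine) (τ : K →ₐ[ℚ] K))
    (fun x => by cases x <;> rfl) (fun g h x => by cases x <;> rfl) H (fun ψ hψ => ?_) hP
  exact kato_finite_chiPart_of_isAbelianGalois_of_twistedLValue_ne_zero hK K W hf ψ (hL ψ hψ)

set_option backward.isDefEq.respectTransparency false in
open scoped Classical in
/-- **`E(K)` is finite for a finite abelian `K/ℚ` when no twisted central `L`-value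
`L(E, ψ, 1)`, `ψ ∈ Gal(K/ℚ)^`, vanishes** (under the vendored Cor. 14.3 (2), `hK`): `E(K)` is
finitely generated (Mordell–Weil over number fields, `addGroup_fg_point_holds`, proved in the
tree) and torsion (`isOfFinAddOrder_point_of_isAbelianGalois_of_kato` with `H = ∅`), hence
finite (Mathlib `AddCommGroup.finite_of_fg_torsion`). This is the "analytic rank `0` ⇒ rank `0`"
statement over abelian number fields, `L(E/K, s) = ∏_ψ L(E, ψ, s)`.
[cite: Kato2004Asterisque, Cor. 14.3 (2) (p. 235)] -/
theorem finite_point_of_isAbelianGalois_of_kato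
    (hK : kato_finite_chiPart_of_twistedLValue_ne_zero) (K : Type*) [Field K] [NumberField K]
    [IsAbelianGalois ℚ K] (W : WeierstrassCurve ℚ) [W.IsElliptic]
    {N : ℕ} [NeZero N] {f : CuspForm (Gamma0 N) 2} (hf : IsNewformOf W f)
    (hL : ∀ (ψ : (K ≃ₐ[ℚ] K) →* ℂˣ) {M : ℕ} [NeZero M] (ι : K →ₐ[ℚ] CyclotomicField M ℚ)
      (χ : DirichletCharacter ℂ M),
      (∀ (σ : CyclotomicField M ℚ ≃ₐ[ℚ] CyclotomicField M ℚ) (τ : K ≃ₐ[ℚ] K),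
        (∀ x, σ (ι x) = ι (τ x)) → (cyclotomicCharacterOf χ σ : ℂ) = ψ τ) →
      ∃ L : ℂ → ℂ, Differentiable ℂ L ∧
        (∀ s : ℂ, 2 < s.re → L s = twistedLSeries f χ s) ∧ L 1 ≠ 0) :
    Finite (W.baseChange K).toAffine.Point := by
  haveI : (W.baseChange K).IsElliptic := by
    rw [WeierstrassCurve.baseChange]; infer_instance
  haveI : AddGroup.FG (W.baseChange K).toAffine.Point := (W.baseChange K).addGroup_fg_point_holds
  refine AddCommGroup.finite_of_fg_torsion _ fun P => ?_
  exact isOfFinAddOrder_point_of_isAbelianGalois_of_kato hK K W hf ∅ (fun ψ _ => hL ψ)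
    (fun _ hh => absurd hh (Set.notMem_empty _))

end Consequences


/-! ### §6. Totally real `K`: only EVEN characters occur -/

section TotallyReal

open ModularForms NumberField

/-- **Two embeddings of a normal extension `K/F` into any field `Ω` differ by an automorphism
of `K`**: `ι₂ = ι₁ ∘ τ` for some `τ ∈ Aut(K/F)` (Mathlib `AlgHom.restrictNormal'` for the tower
`F ⊂ K ⊂ Ω` defined by `ι₁`; compare `exists_algEquiv_comp_algHom_eq`, where instead the target
is normal). [folklore] -/
theorem exists_algEquiv_comp_eq_algHom {F K Ω : Type*} [Field F] [Field K] [Field Ω]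
    [Algebra F K] [Algebra F Ω] [Normal F K] (ι₁ ι₂ : K →ₐ[F] Ω) :
    ∃ τ : K ≃ₐ[F] K, ∀ x, ι₁ (τ x) = ι₂ x := by
  letI : Algebra K Ω := ι₁.toRingHom.toAlgebra
  haveI : IsScalarTower F K Ω := IsScalarTower.of_algebraMap_eq fun x => (ι₁.commutes x).symm
  exact ⟨ι₂.restrictNormal' K, fun x => AlgHom.restrictNormal_commutes ι₂ K x⟩

variable {M : ℕ} [NeZero M]

omit [NeZero M] in
set_option backward.isDefEq.respectTransparency false in
/-- **Complex conjugation on `ℚ(ζ_M)`.** For every embedding `φ : ℚ(ζ_M) → ℂ` there is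
`c ∈ Gal(ℚ(ζ_M)/ℚ)` with `φ ∘ c = conj ∘ φ` (`ℚ(ζ_M)/ℚ` is normal; `exists_algEquiv_comp_eq_algHom`
applied to `φ` and `conj ∘ φ`). [folklore] -/
theorem exists_algEquiv_apply_eq_conj (φ : CyclotomicField M ℚ →+* ℂ) :
    ∃ c : CyclotomicField M ℚ ≃ₐ[ℚ] CyclotomicField M ℚ, ∀ x, φ (c x) = starRingEnd ℂ (φ x) := by
  haveI : IsGalois ℚ (CyclotomicField M ℚ) := IsCyclotomicExtension.isGalois {M} ℚ _
  obtain ⟨c, hc⟩ := exists_algEquiv_comp_eq_algHom (F := ℚ) φ.toRatAlgHom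
    ((starRingEnd ℂ).comp φ).toRatAlgHom
  exact ⟨c, fun x => hc x⟩

set_option backward.isDefEq.respectTransparency false in
/-- **Complex conjugation acts as `-1 ∈ (ℤ/M)ˣ`**: if `φ ∘ c = conj ∘ φ` then `c(ζ) = ζ⁻¹` for the
`M`-th roots of unity (their images in `ℂ` have absolute value `1`), so the canonical isomorphism
`Gal(ℚ(ζ_M)/ℚ) ≅ (ℤ/M)ˣ` (`autEquivPow`) sends `c` to `-1`. [folklore] -/
theorem coe_autEquivPow_eq_neg_one_of_apply_eq_conj (φ : CyclotomicField M ℚ →+* ℂ)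
    {c : CyclotomicField M ℚ ≃ₐ[ℚ] CyclotomicField M ℚ} (hc : ∀ x, φ (c x) = starRingEnd ℂ (φ x)) :
    ((IsCyclotomicExtension.autEquivPow (CyclotomicField M ℚ)
        (cyclotomic.irreducible_rat (NeZero.pos M)) c : (ZMod M)ˣ) : ZMod M) = -1 := by
  have hζ := IsCyclotomicExtension.zeta_spec M ℚ (CyclotomicField M ℚ)
  set ζ := IsCyclotomicExtension.zeta M ℚ (CyclotomicField M ℚ)
  rw [IsCyclotomicExtension.autEquivPow_apply]
  set a := hζ.autToPow ℚ c with ha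
  have hspec : ζ ^ (a : ZMod M).val = c ζ := hζ.autToPow_spec ℚ c
  -- `c ζ = ζ⁻¹`
  have hcζ : c ζ = ζ⁻¹ := by
    apply φ.injective
    rw [hc, map_inv₀, Complex.inv_eq_conj]
    exact (hζ.map_of_injective φ.injective).norm'_eq_one (NeZero.ne M)
  -- hence `ζ ^ (a.val + 1) = 1`, `M ∣ a.val + 1`, `a = -1`
  have h1 : ζ ^ ((a : ZMod M).val + 1) = 1 := by
    rw [pow_succ, hspec, hcζ, inv_mul_cancel₀ (hζ.ne_zero (NeZero.ne M))]
  have hdvd : M ∣ (a : ZMod M).val + 1 := (hζ.pow_eq_one_iff_dvd _).mp h1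
  have h0 : (((a : ZMod M).val + 1 : ℕ) : ZMod M) = 0 := (ZMod.natCast_eq_zero_iff _ _).mpr hdvd
  rw [Nat.cast_add, Nat.cast_one, ZMod.natCast_zmod_val] at h0
  have : ((hζ.autToPow ℚ c : (ZMod M)ˣ) : ZMod M) = -1 := by
    rw [← ha]; exact eq_neg_of_add_eq_zero_left h0
  simpa only [MonoidHom.toFun_eq_coe] using this

set_option backward.isDefEq.respectTransparency false in
/-- The character of `Gal(ℚ(ζ_M)/ℚ)` attached to a Dirichlet character `χ` mod `M` takes the
value `χ(-1)` at complex conjugation. [folklore] -/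
theorem coe_cyclotomicCharacterOf_of_apply_eq_conj (χ : DirichletCharacter ℂ M)
    (φ : CyclotomicField M ℚ →+* ℂ) {c : CyclotomicField M ℚ ≃ₐ[ℚ] CyclotomicField M ℚ}
    (hc : ∀ x, φ (c x) = starRingEnd ℂ (φ x)) :
    (cyclotomicCharacterOf χ c : ℂ) = χ (-1) := by
  rw [coe_cyclotomicCharacterOf_apply, coe_autEquivPow_eq_neg_one_of_apply_eq_conj φ hc]

omit [NeZero M] in
set_option backward.isDefEq.respectTransparency false in
/-- **Complex conjugation fixes (the image of) a totally real field**: for `K` totally real and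
`ι : K → ℚ(ζ_M)`, any `c` with `φ ∘ c = conj ∘ φ` fixes `ι(K)` pointwise (every complex embedding
of `K`, e.g. `φ ∘ ι`, is real). [folklore] -/
theorem apply_eq_of_isTotallyReal_of_apply_eq_conj {K : Type*} [Field K] [Algebra ℚ K]
    [IsTotallyReal K] (ι : K →ₐ[ℚ] CyclotomicField M ℚ) (φ : CyclotomicField M ℚ →+* ℂ)
    {c : CyclotomicField M ℚ ≃ₐ[ℚ] CyclotomicField M ℚ}
    (hc : ∀ x, φ (c x) = starRingEnd ℂ (φ x)) (x : K) : c (ι x) = ι x := by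
  apply φ.injective
  rw [hc]
  have hreal := IsTotallyReal.complexEmbedding_isReal (φ.comp (ι : K →+* CyclotomicField M ℚ))
  rw [ComplexEmbedding.isReal_iff] at hreal
  exact RingHom.congr_fun hreal x

set_option backward.isDefEq.respectTransparency false in
/-- **For a totally real `K`, every character of `Gal(K/ℚ)` is EVEN as a Dirichlet character**:
if `χ` mod `M` inflates a character `ψ` of `Aut(K/ℚ)` along `ι : K → ℚ(ζ_M)` and `K` is totally
real, then `χ(-1) = 1` (`DirichletCharacter.Even`): complex conjugation `c ∈ Gal(ℚ(ζ_M)/ℚ)` fixes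
`ι(K)` pointwise, so `χ(c) = ψ(1) = 1` (`cyclotomicCharacterOf_eq_one_of_inflating`), while
`χ(c) = χ(-1)`. Equivalently `K ⊂ ℚ(ζ_M)⁺`; so over totally real abelian fields Kato's Cor. 14.3
(2) only ever involves even twists `L(E, χ, 1)`, `χ(-1) = 1`. [folklore] -/
theorem even_of_inflating_of_isTotallyReal {K : Type*} [Field K] [Algebra ℚ K] [IsTotallyReal K]
    (ι : K →ₐ[ℚ] CyclotomicField M ℚ) (ψ : (K ≃ₐ[ℚ] K) →* ℂˣ) {χ : DirichletCharacter ℂ M}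
    (hχ : ∀ (σ : CyclotomicField M ℚ ≃ₐ[ℚ] CyclotomicField M ℚ) (τ : K ≃ₐ[ℚ] K),
      (∀ x, σ (ι x) = ι (τ x)) → (cyclotomicCharacterOf χ σ : ℂ) = ψ τ) :
    χ.Even := by
  obtain ⟨φ⟩ : Nonempty (CyclotomicField M ℚ →+* ℂ) := by
    rw [← Fintype.card_pos_iff, NumberField.Embeddings.card]
    exact Module.finrank_pos
  obtain ⟨c, hc⟩ := exists_algEquiv_apply_eq_conj φ
  have h1 := cyclotomicCharacterOf_eq_one_of_inflating ι ψ hχ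
    (apply_eq_of_isTotallyReal_of_apply_eq_conj ι φ hc)
  have h2 := coe_cyclotomicCharacterOf_of_apply_eq_conj χ φ hc
  rw [DirichletCharacter.Even, ← h2, h1, Units.val_one]

set_option backward.isDefEq.respectTransparency false in
open scoped Classical in
/-- **Kato's Cor. 14.3 (2) over a totally real abelian field needs only even twists.** Under the
vendored fact `hK`: for `K/ℚ` finite abelian and totally real and `E/ℚ` an elliptic curve with
newform `f`, if for every character `ψ` of `Gal(K/ℚ)` and every datum `(M, ι, χ)` of `ψ` with `χ`
EVEN the series `L_{prime(M)}(f, χ, s)` has an entire continuation non-vanishing at `1`, then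
`E(K)` is finite (`finite_point_of_isAbelianGalois_of_kato`; the evenness restriction is free by
`even_of_inflating_of_isTotallyReal`). [cite: Kato2004Asterisque, Cor. 14.3 (2) (p. 235)] -/
theorem finite_point_of_isTotallyReal_of_kato
    (hK : kato_finite_chiPart_of_twistedLValue_ne_zero) (K : Type*) [Field K] [NumberField K]
    [IsAbelianGalois ℚ K] [IsTotallyReal K] (W : WeierstrassCurve ℚ) [W.IsElliptic]
    {N : ℕ} [NeZero N] {f : CuspForm (Gamma0 N) 2} (hf : IsNewformOf W f)
    (hL : ∀ (ψ : (K ≃ₐ[ℚ] K) →* ℂˣ) {M : ℕ} [NeZero M] (ι : K →ₐ[ℚ] CyclotomicField M ℚ)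
      (χ : DirichletCharacter ℂ M), χ.Even →
      (∀ (σ : CyclotomicField M ℚ ≃ₐ[ℚ] CyclotomicField M ℚ) (τ : K ≃ₐ[ℚ] K),
        (∀ x, σ (ι x) = ι (τ x)) → (cyclotomicCharacterOf χ σ : ℂ) = ψ τ) →
      ∃ L : ℂ → ℂ, Differentiable ℂ L ∧
        (∀ s : ℂ, 2 < s.re → L s = twistedLSeries f χ s) ∧ L 1 ≠ 0) :
    Finite (W.baseChange K).toAffine.Point :=
  finite_point_of_isAbelianGalois_of_kato hK K W hf fun ψ _ _ ι χ hχ =>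
    hL ψ ι χ (even_of_inflating_of_isTotallyReal ι ψ hχ) hχ

end TotallyReal


/-! ### §7. Totally real `K → ℚ(ζ_M)`: torsion and finiteness from the even `χ`-parts alone -/

section TotallyRealDescent

open ModularForms NumberField

variable {M : ℕ} [NeZero M]

set_option backward.isDefEq.respectTransparency false in
/-- **A character of `Gal(ℚ(ζ_M)/ℚ)` is trivial at complex conjugation iff it is even.** For a
Dirichlet character `χ` mod `M` and `c ∈ Gal(ℚ(ζ_M)/ℚ)` with `φ ∘ c = conj ∘ φ` for some embedding
`φ : ℚ(ζ_M) → ℂ`: `cyclotomicCharacterOf χ c = 1 ↔ χ(-1) = 1` (`DirichletCharacter.Even`), since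
`cyclotomicCharacterOf χ c = χ(-1)` (`coe_cyclotomicCharacterOf_of_apply_eq_conj`). So "the
characters trivial on `{1, c}`", i.e. those of `Gal(ℚ(ζ_M)⁺/ℚ)`, are exactly the even Dirichlet
characters mod `M`. [folklore] -/
theorem cyclotomicCharacterOf_eq_one_iff_even_of_apply_eq_conj (χ : DirichletCharacter ℂ M)
    (φ : CyclotomicField M ℚ →+* ℂ) {c : CyclotomicField M ℚ ≃ₐ[ℚ] CyclotomicField M ℚ}
    (hc : ∀ x, φ (c x) = starRingEnd ℂ (φ x)) :
    cyclotomicCharacterOf χ c = 1 ↔ χ.Even := by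
  rw [DirichletCharacter.Even, ← coe_cyclotomicCharacterOf_of_apply_eq_conj χ φ hc, Units.val_eq_one]

set_option backward.isDefEq.respectTransparency false in
/-- **Descent to a totally real field from the even `χ`-parts (Kato-free).** Let `W/ℚ` be a
Weierstrass curve, `M ≥ 1`, and suppose that the `χ`-part
`E(ℚ(ζ_M))^(χ) = {x ; I_χ · x = 0}` of `E(ℚ(ζ_M)) = (W.baseChange ℚ(ζ_M))(ℚ(ζ_M))` (Galois action
`σ ↦ Point.map σ`, `χ` read as `cyclotomicCharacterOf χ` — the objects of the tree's Kato facts)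
is finite for every EVEN Dirichlet character `χ` mod `M` (the trivial one included). Then for
every totally real field `K` with an embedding `ι : K → ℚ(ζ_M)` of `ℚ`-algebras, every point of
`E(K) = (W.baseChange K)(K)` has finite order. Proof: fix `φ : ℚ(ζ_M) → ℂ` and complex conjugation
`c ∈ Gal(ℚ(ζ_M)/ℚ)`, `φ ∘ c = conj ∘ φ` (`exists_algEquiv_apply_eq_conj`); `c` fixes `ι(K)`
pointwise because `K` is totally real (`apply_eq_of_isTotallyReal_of_apply_eq_conj`), so
`Q = ι_* P` is fixed by `c` (`Point.map_map`); the characters of `Gal(ℚ(ζ_M)/ℚ)` trivial on `{c}`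
are the even ones (`cyclotomicCharacterOf_eq_one_iff_even_of_apply_eq_conj`), so by the isotypic
exhaustion of the `{c}`-fixed part by their `χ`-parts (`isOfFinAddOrder_point_of_forall_finite_chiPart`,
`KatoTwistedFinitenessIsotypicProofs.lean`, Kato's remark p. 236) `Q` has finite order, hence so
has `P` (`Point.map ι` is an injective homomorphism, Mathlib `Point.map_injective`). The
decidability instances carrying the group laws on `E(K)` and `E(ℚ(ζ_M))` are arbitrary. This is
the algebra by which Kato's Cor. 14.3 (2) over `ℚ(ζ_M)` controls the Mordell–Weil groups of the
totally real fields inside `ℚ(ζ_M)` (as in Thm. 14.4, p. 236, along the tower `∪ₙ ℚ(ζ_{m^n})`).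
[folklore] [cite: Kato2004Asterisque, Cor. 14.3 (2) (p. 235) and remark p. 236] -/
theorem isOfFinAddOrder_point_of_isTotallyReal_of_forall_even_finite_chiPart
    (W : WeierstrassCurve ℚ) [DecidableEq (CyclotomicField M ℚ)]
    (hfin : ∀ χ : DirichletCharacter ℂ M, χ.Even →
      Finite (chiPart
        (fun σ : CyclotomicField M ℚ ≃ₐ[ℚ] CyclotomicField M ℚ =>
          Point.map (W' := W.toAffine) (σ : CyclotomicField M ℚ →ₐ[ℚ] CyclotomicField M ℚ))
        (fun σ => (cyclotomicCharacterOf χ σ : ℂ))))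
    {K : Type*} [Field K] [Algebra ℚ K] [IsTotallyReal K] [DecidableEq K]
    (ι : K →ₐ[ℚ] CyclotomicField M ℚ) (P : (W.baseChange K).toAffine.Point) :
    IsOfFinAddOrder P := by
  -- an embedding `φ : ℚ(ζ_M) → ℂ` and complex conjugation `c ∈ Gal(ℚ(ζ_M)/ℚ)`
  obtain ⟨φ⟩ : Nonempty (CyclotomicField M ℚ →+* ℂ) := by
    rw [← Fintype.card_pos_iff, NumberField.Embeddings.card]
    exact Module.finrank_pos
  obtain ⟨c, hc⟩ := exists_algEquiv_apply_eq_conj φ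
  -- `c ∘ ι = ι` (`K` totally real), so `Q = ι_* P` is fixed by `c`
  have hcomp : (c : CyclotomicField M ℚ →ₐ[ℚ] CyclotomicField M ℚ).comp ι = ι :=
    AlgHom.ext fun x => apply_eq_of_isTotallyReal_of_apply_eq_conj ι φ hc x
  have hQ : ∀ h ∈ ({c} : Set (CyclotomicField M ℚ ≃ₐ[ℚ] CyclotomicField M ℚ)),
      Point.map (W' := W.toAffine) (h : CyclotomicField M ℚ →ₐ[ℚ] CyclotomicField M ℚ)
        (Point.map (W' := W.toAffine) ι P) = Point.map (W' := W.toAffine) ι P := by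
    intro h hh
    rw [Set.mem_singleton_iff] at hh
    subst hh
    rw [Point.map_map, hcomp]
  -- the characters trivial on `{c}` are the even ones, whose `χ`-parts are finite: `Q` is torsion
  have hQfin : IsOfFinAddOrder (Point.map (W' := W.toAffine) ι P) :=
    isOfFinAddOrder_point_of_forall_finite_chiPart W {c}
      (fun χ hχ => hfin χ ((cyclotomicCharacterOf_eq_one_iff_even_of_apply_eq_conj χ φ hc).mp
        (hχ c (Set.mem_singleton c)))) hQ
  -- `Point.map ι` is injective
  exact (Point.map_injective (W' := W.toAffine) (f := ι)).isOfFinAddOrder_iff.mp hQfin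

set_option backward.isDefEq.respectTransparency false in
/-- `isOfFinAddOrder_point_of_isTotallyReal_of_forall_even_finite_chiPart` for a totally real `K`
handed over with a RING embedding `ι : K →+* ℚ(ζ_M)` (automatically `ℚ`-linear,
Mathlib `RingHom.toRatAlgHom`): finite even `χ`-parts of `E(ℚ(ζ_M))` force every point of `E(K)`
to be torsion. [folklore] [cite: Kato2004Asterisque, Cor. 14.3 (2) (p. 235) and remark p. 236] -/
theorem isOfFinAddOrder_point_of_isTotallyReal_of_forall_even_finite_chiPart_of_ringHom
    (W : WeierstrassCurve ℚ) [DecidableEq (CyclotomicField M ℚ)]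
    (hfin : ∀ χ : DirichletCharacter ℂ M, χ.Even →
      Finite (chiPart
        (fun σ : CyclotomicField M ℚ ≃ₐ[ℚ] CyclotomicField M ℚ =>
          Point.map (W' := W.toAffine) (σ : CyclotomicField M ℚ →ₐ[ℚ] CyclotomicField M ℚ))
        (fun σ => (cyclotomicCharacterOf χ σ : ℂ))))
    {K : Type*} [Field K] [Algebra ℚ K] [IsTotallyReal K] [DecidableEq K]
    (ι : K →+* CyclotomicField M ℚ) (P : (W.baseChange K).toAffine.Point) :
    IsOfFinAddOrder P :=
  isOfFinAddOrder_point_of_isTotallyReal_of_forall_even_finite_chiPart W hfin ι.toRatAlgHom P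

set_option backward.isDefEq.respectTransparency false in
open scoped Classical in
/-- **`E(K)` is finite for a totally real `K → ℚ(ζ_M)` when the even `χ`-parts of `E(ℚ(ζ_M))`
are finite.** For an elliptic curve `E/ℚ` (`W.IsElliptic`), `M ≥ 1`, and a totally real NUMBER
FIELD `K` with a ring embedding `K →+* ℚ(ζ_M)`: if `E(ℚ(ζ_M))^(χ)` is finite for every even
Dirichlet character `χ` mod `M`, then `E(K)` is finite — it is finitely generated (Mordell–Weil
over number fields, `addGroup_fg_point_holds`, proved in the tree) and torsion
(`isOfFinAddOrder_point_of_isTotallyReal_of_forall_even_finite_chiPart_of_ringHom`), Mathlib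
`AddCommGroup.finite_of_fg_torsion`. [folklore]
[cite: Kato2004Asterisque, Cor. 14.3 (2) (p. 235) and remark p. 236] -/
theorem finite_point_of_isTotallyReal_of_forall_even_finite_chiPart
    (W : WeierstrassCurve ℚ) [W.IsElliptic]
    (hfin : ∀ χ : DirichletCharacter ℂ M, χ.Even →
      Finite (chiPart
        (fun σ : CyclotomicField M ℚ ≃ₐ[ℚ] CyclotomicField M ℚ =>
          Point.map (W' := W.toAffine) (σ : CyclotomicField M ℚ →ₐ[ℚ] CyclotomicField M ℚ))
        (fun σ => (cyclotomicCharacterOf χ σ : ℂ))))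
    (K : Type*) [Field K] [NumberField K] [IsTotallyReal K] (ι : K →+* CyclotomicField M ℚ) :
    Finite (W.baseChange K).toAffine.Point := by
  haveI : (W.baseChange K).IsElliptic := by
    rw [WeierstrassCurve.baseChange]; infer_instance
  haveI : AddGroup.FG (W.baseChange K).toAffine.Point := (W.baseChange K).addGroup_fg_point_holds
  exact AddCommGroup.finite_of_fg_torsion _ fun P =>
    isOfFinAddOrder_point_of_isTotallyReal_of_forall_even_finite_chiPart_of_ringHom W hfin ι P

set_option backward.isDefEq.respectTransparency false in
open scoped Classical in
/-- **Kato's Cor. 14.3 (2) along the totally real part of a cyclotomic field: non-vanishing of the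
EVEN twists kills `E(K)` for every totally real `K → ℚ(ζ_M)`.** Assume the vendored fact `hK`
(Kato, Astérisque 295, Cor. 14.3 (2) over `ℚ(ζ_m)`, least moduli; all moduli by
`kato_finite_chiPart_cyclotomic_of_twistedLValue_ne_zero_of`). Let `E/ℚ` be an elliptic curve
with newform `f` (`IsNewformOf W f`) and `M ≥ 1`, and suppose that for every EVEN Dirichlet
character `χ` mod `M` the twisted series `L_{prime(M)}(f, χ, s) = ∑ χ(n) aₙ(f) n⁻ˢ`
(`twistedLSeries f χ`, `re s > 2`) has an entire continuation non-vanishing at `s = 1`. Then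
`E(K)` is finite for every totally real number field `K` with a ring embedding `K →+* ℚ(ζ_M)` —
i.e. for every subfield of `ℚ(ζ_M)⁺`: Kato's theorem makes the even `χ`-parts of `E(ℚ(ζ_M))`
finite, and `finite_point_of_isTotallyReal_of_forall_even_finite_chiPart` descends. (Odd `χ`
never enter: complex conjugation fixes `K`; compare `finite_point_of_isTotallyReal_of_kato`, the
same statement for an abstract totally real abelian `K`, and Kato's Thm. 14.4, p. 236.)
[cite: Kato2004Asterisque, Cor. 14.3 (2) (p. 235) and remark p. 236] -/
theorem finite_point_of_isTotallyReal_cyclotomic_of_kato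
    (hK : kato_finite_chiPart_of_twistedLValue_ne_zero) (W : WeierstrassCurve ℚ) [W.IsElliptic]
    {N : ℕ} [NeZero N] {f : CuspForm (Gamma0 N) 2} (hf : IsNewformOf W f)
    (hL : ∀ χ : DirichletCharacter ℂ M, χ.Even →
      ∃ L : ℂ → ℂ, Differentiable ℂ L ∧
        (∀ s : ℂ, 2 < s.re → L s = twistedLSeries f χ s) ∧ L 1 ≠ 0)
    (K : Type*) [Field K] [NumberField K] [IsTotallyReal K] (ι : K →+* CyclotomicField M ℚ) :
    Finite (W.baseChange K).toAffine.Point :=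
  finite_point_of_isTotallyReal_of_forall_even_finite_chiPart W
    (fun χ hχ => kato_finite_chiPart_cyclotomic_of_twistedLValue_ne_zero_of hK W hf χ (hL χ hχ))
    K ι

end TotallyRealDescent

end Literature.NumberTheory.EllipticCurves

end
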